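import Summits.NavierStokesRegularity.NavierStokesRegularity.Theorems.TypeICertificateLadderNoTypeIBlowupMorrey
import Summits.NavierStokesRegularity.NavierStokesRegularity.Theorems.TypeICertificateLadderNoTypeIBlowupLemma35
import Summits.NavierStokesRegularity.NavierStokesRegularity.Theorems.TypeICertificateLadderNoTypeIBlowupZoom
import Literature.Analysis.FluidPDE.LocalTypeILiouville
import Literature.Analysis.FluidPDE.LocalTypeICharacterization

/-!
# Route TypeICertificateLadder — crux `NoTypeIBlowup` (item stmt-NavierStokesRegularity-1217):
# the Morrey bound of a Type I solution, and `¬ LocalTypeISingularityExists → NoTypeIBlowup`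

Helper file (theorems only) towards the crux `NoTypeIBlowup` (symmetry-free Type I exclusion for
Clay data — OPEN). Main results:

* `morrey_of_typeI` — a classical solution of Navier–Stokes (viscosity `ν > 0`) on `ℝ³ × [0, T)`,
  Leray–Hopf on `[0, T)`, blowing up at most at the Type I rate at `T` (`IsTypeIBlowup u T`),
  satisfies the Morrey-type bound `∫_{B(x₁, ρ)} |u(t)|² ≤ M ρ` for all centres `x₁`, all radii
  `0 < ρ ≤ r₀` and all `t` in a final interval `(T₁, T)`, with SOLUTION-DEPENDENT constants — the
  Type I condition (e.typeI) of Barker–Prange 2020 / the hypothesis of Albritton–Barker's local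
  theory. Proof: zoom about `(T', x₁)` at a fixed scale (`zoom_unitCyl_data`), Seregin–Šverák's
  Lemma 3.5 without axial symmetry and with explicit constants (`scaledEnergy_vertex_le_of_typeI`),
  whose data are bounded uniformly in the centre by the global energy, dissipation and the slab
  `L^{3/2}` norm of the gauged pressure; the essential-supremum bound on `A(0, r; w)` is transported
  back to physical variables and upgraded to every time slice by continuity of
  `t ↦ ∫_{B(x₁, ρ)} |u(t)|²` (`u` classical below `T`).
* `noTypeIBlowup_of_not_localTypeISingularityExists` —
  **`¬ LocalTypeISingularityExists → NoTypeIBlowup`**: the crux follows from the non-existence of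
  local Type I singular points of suitable weak solutions in the sense of Albritton–Barker 2019,
  Thm. 1.1 (the registered OPEN statement `LocalTypeISingularityExists` of `LocalTypeI.lean`,
  negated), with NO further hypothesis (the tree's
  `isBackwardBoundedAt_of_morrey_of_not_localTypeISingularityExists` fed with `morrey_of_typeI`,
  and Lemarié-Rieusset 2016 Thm. 15.1 (C)). This supersedes the route's use of item 2884 in
  `noTypeIBlowup_of_scaledEnergyBound_of_not_localTypeISingularityExists`.
* `noTypeIBlowup_of_albrittonBarkerForward_of_not_nontrivialMildAncientTypeIExists` and
  `noTypeIBlowup_of_liouvilleConjectureNS` — the same through Albritton–Barker's forward theorem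
  (`AlbrittonBarkerForward`, named fact) and either the negated open statement
  `NontrivialMildAncientTypeIExists` (no Type I blow-up profile) or the Liouville conjecture (L)
  (`LiouvilleConjectureNS`, items stmt-0057 and stmt-10661) with the forward theorem in measurable-slice
  form (see `LocalTypeILiouville.lean` for the measurability proviso).

So, kernel-checked: **(L) + Albritton–Barker's forward theorem (measurable-slice form) ⇒ no
Type I blow-up for Clay data** — the Koch–Nadirashvili–Seregin–Šverák 2009 / Seregin–Šverák 2009
programme "(L) rules out Type I blow-up", for the Clay class, modulo those two inputs. All results
are CONDITIONAL on their displayed hypotheses; nothing here closes item 1217.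
-/

noncomputable section

namespace Summit.NavierStokesRegularity.NavierStokesRegularity.Theorems

open MeasureTheory Set Function Filter Topology TopologicalSpace Metric
open Literature.Analysis.FluidPDE Literature.Analysis.FluidPDE.SereginSverak2009
open scoped NNReal ENNReal

/-! ### From `A(0, r; w) ≤ Λ` back to physical balls -/

/-- **Physical reading of a bound on `A(0, r; w)` for the zoom `w = α u ∘ Φ`,
`Φ(σ, y) = (T' + βσ, x₁ + Ry)`**: if `A(0, r; w) ≤ Λ`, `0 < r`, and `ρ ≤ R r`, then for a.e.
`t ∈ (T' − βr², T')`, `∫_{B(x₁, ρ)} |u(t)|² ≤ R³ α⁻² r Λ` (in `ℝ≥0∞`): the defining essential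
supremum of `A` gives `∫_{𝒞(0, r)} |w(σ)|² ≤ r Λ` for a.e. `σ ∈ (-r², 0)`, the ball
`B(0, ρ/R) ⊆ 𝒞(0, r)` is the preimage of `B(x₁, ρ)` under `y ↦ x₁ + Ry` (`dy = R⁻³ dx`), and the
time change `t = T' + βσ` transports the a.e. statement.
[cite: SereginSverak2009, §3 (definition of A, arXiv p. 9)] -/
theorem ae_ball_bound_of_energyA_le {u : ℝ → EuclideanSpace ℝ (Fin 3) → EuclideanSpace ℝ (Fin 3)}
    {R α β T' : ℝ} (hR : 0 < R) (hα : 0 < α) (hβ : 0 < β) (x₁ : EuclideanSpace ℝ (Fin 3))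
    {r : ℝ} (hr : 0 < r) {Λ : ℝ≥0∞} (h : energyA 0 r (α • stPull β R T' x₁ u) ≤ Λ)
    {ρ : ℝ} (hρr : ρ ≤ R * r) :
    ∀ᵐ t ∂(volume.restrict (Ioo (T' - β * r ^ 2) T')),
      ∫⁻ x in ball x₁ ρ, ‖u t x‖ₑ ^ 2 ≤ ENNReal.ofReal (R ^ 3) * ((‖α‖ₑ ^ 2)⁻¹ * (ENNReal.ofReal r * Λ)) := by
  -- the a.e. bound in the rescaled time
  have hσ : ∀ᵐ σ ∂(volume.restrict (Ioo ((0 : ℝ) - r ^ 2) 0)),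
      (ENNReal.ofReal r)⁻¹ * ∫⁻ y in spaceCyl (0 : EuclideanSpace ℝ (Fin 3)) r,
        ‖(α • stPull β R T' x₁ u) σ y‖ₑ ^ 2 ≤ Λ := by
    have h1 := ENNReal.ae_le_essSup (μ := volume.restrict (Ioo ((0 : ℝ) - r ^ 2) 0))
      (fun σ => (ENNReal.ofReal r)⁻¹ * ∫⁻ y in spaceCyl (0 : EuclideanSpace ℝ (Fin 3)) r,
        ‖(α • stPull β R T' x₁ u) σ y‖ₑ ^ 2)
    filter_upwards [h1] with σ hσ
    exact hσ.trans h
  -- rewritten as a bound on the physical ball at time `T' + βσ`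
  have hρ0 : ENNReal.ofReal r ≠ 0 := (ENNReal.ofReal_pos.2 hr).ne'
  have hα0 : ‖α‖ₑ ^ 2 ≠ 0 := pow_ne_zero _ (by simp [hα.ne'])
  have hαT : ‖α‖ₑ ^ 2 ≠ ⊤ := ENNReal.pow_ne_top enorm_ne_top
  have hR3 : ENNReal.ofReal (R ^ 3) * ENNReal.ofReal (R ^ 3)⁻¹ = 1 := by
    rw [← ENNReal.ofReal_mul (by positivity), mul_inv_cancel₀ (by positivity), ENNReal.ofReal_one]
  have hσ' : ∀ᵐ σ ∂(volume.restrict (Ioo ((0 : ℝ) - r ^ 2) 0)),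
      ∫⁻ x in ball x₁ ρ, ‖u (T' + β * σ) x‖ₑ ^ 2 ≤
        ENNReal.ofReal (R ^ 3) * ((‖α‖ₑ ^ 2)⁻¹ * (ENNReal.ofReal r * Λ)) := by
    filter_upwards [hσ] with σ hσ
    -- `∫_{𝒞(0,r)} |w(σ)|² ≤ r Λ`
    have h1 : ∫⁻ y in spaceCyl (0 : EuclideanSpace ℝ (Fin 3)) r, ‖(α • stPull β R T' x₁ u) σ y‖ₑ ^ 2 ≤
        ENNReal.ofReal r * Λ := by
      calc ∫⁻ y in spaceCyl (0 : EuclideanSpace ℝ (Fin 3)) r, ‖(α • stPull β R T' x₁ u) σ y‖ₑ ^ 2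
          = ENNReal.ofReal r * ((ENNReal.ofReal r)⁻¹ *
              ∫⁻ y in spaceCyl (0 : EuclideanSpace ℝ (Fin 3)) r, ‖(α • stPull β R T' x₁ u) σ y‖ₑ ^ 2) := by
            rw [← mul_assoc, ENNReal.mul_inv_cancel hρ0 ENNReal.ofReal_ne_top, one_mul]
        _ ≤ ENNReal.ofReal r * Λ := mul_le_mul' le_rfl hσ
    -- the ball `B(0, ρ/R) ⊆ 𝒞(0, r)` and the change of variables
    have hsub : ball (0 : EuclideanSpace ℝ (Fin 3)) (ρ / R) ⊆ spaceCyl (0 : EuclideanSpace ℝ (Fin 3)) r :=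
      (ball_subset_ball (by rw [div_le_iff₀ hR]; linarith)).trans (ball_subset_spaceCyl 0 r)
    have hpre : (fun y : EuclideanSpace ℝ (Fin 3) => x₁ + R • y) ⁻¹' ball x₁ ρ =
        ball (0 : EuclideanSpace ℝ (Fin 3)) (ρ / R) := by
      rw [space_affine_preimage_ball hR x₁ x₁ ρ, sub_self, smul_zero]
    have h2 : ‖α‖ₑ ^ 2 * (ENNReal.ofReal (R ^ 3)⁻¹ * ∫⁻ x in ball x₁ ρ, ‖u (T' + β * σ) x‖ₑ ^ 2) ≤
        ENNReal.ofReal r * Λ := by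
      have e1 := setLIntegral_preimage_comp_space_affine hR x₁
        (fun x => ‖u (T' + β * σ) x‖ₑ ^ 2) (ball x₁ ρ)
      rw [finrank_euclideanSpace_fin, hpre] at e1
      rw [← e1, ← lintegral_const_mul' _ _ hαT]
      refine le_trans ?_ h1
      refine (lintegral_mono_set hsub).trans (lintegral_mono fun y => le_of_eq ?_)
      rw [smul_stPull_apply, enorm_smul, mul_pow]
    calc ∫⁻ x in ball x₁ ρ, ‖u (T' + β * σ) x‖ₑ ^ 2
        = ENNReal.ofReal (R ^ 3) * ((‖α‖ₑ ^ 2)⁻¹ * (‖α‖ₑ ^ 2 *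
            (ENNReal.ofReal (R ^ 3)⁻¹ * ∫⁻ x in ball x₁ ρ, ‖u (T' + β * σ) x‖ₑ ^ 2))) := by
          rw [← mul_assoc (‖α‖ₑ ^ 2)⁻¹, ENNReal.inv_mul_cancel hα0 hαT, one_mul, ← mul_assoc, hR3,
            one_mul]
      _ ≤ ENNReal.ofReal (R ^ 3) * ((‖α‖ₑ ^ 2)⁻¹ * (ENNReal.ofReal r * Λ)) := by gcongr
  -- transport `σ ↦ t = T' + βσ`
  have hβi : 0 < β⁻¹ := inv_pos.2 hβ
  have e1 : -(β⁻¹ * T') + β⁻¹ * (T' - β * r ^ 2) = (0 : ℝ) - r ^ 2 := by field_simp; ring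
  have e2 : -(β⁻¹ * T') + β⁻¹ * T' = (0 : ℝ) := by ring
  rw [← e1, ← e2] at hσ'
  have h3 := ae_restrict_Ioo_comp_time_affine hβi (-(β⁻¹ * T')) (T' - β * r ^ 2) T' hσ'
  filter_upwards [h3] with t ht
  have e3 : T' + β * (-(β⁻¹ * T') + β⁻¹ * t) = t := by field_simp; ring
  rwa [e3] at ht

/-! ### Continuity of the local energy in time below the blow-up time -/

/-- **`t ↦ ∫_{B(x₁, ρ)} |u(t)|²` is continuous on any interval `(a, b)` of the rate window
below the top time** (`T − δ ≤ a`, `b ≤ T`): `u` is jointly continuous on `[0, T) × ℝ³` and, on a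
neighbourhood of each `t₀ < b ≤ T` inside the window, dominated by the constant
`C²/(T − t₁)`, `t₁ = (t₀ + T)/2` (the Type I rate); dominated convergence
(`continuousAt_of_dominated`) on the finite-measure ball. [folklore] -/
theorem continuousOn_setIntegral_ball_norm_sq {ν T : ℝ}
    {u : ℝ → EuclideanSpace ℝ (Fin 3) → EuclideanSpace ℝ (Fin 3)} {p : ℝ → EuclideanSpace ℝ (Fin 3) → ℝ}
    (hsol : IsClassicalNSSolutionOn (Ico 0 T) ν 0 u p)
    {C δ : ℝ} (hδT : δ ≤ T) (hrate : ∀ t ∈ Ioo (T - δ) T, ∀ x, Real.sqrt (T - t) * ‖u t x‖ ≤ C)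
    (x₁ : EuclideanSpace ℝ (Fin 3)) (ρ : ℝ) {a b : ℝ} (ha : T - δ ≤ a) (hb : b ≤ T) :
    ContinuousOn (fun t => ∫ x in ball x₁ ρ, ‖u t x‖ ^ 2) (Ioo a b) := by
  intro t₀ ht₀
  refine ContinuousAt.continuousWithinAt ?_
  have ht₀T : t₀ < T := ht₀.2.trans_le hb
  have ht₀0 : 0 < t₀ := by linarith [ht₀.1]
  -- a neighbourhood `(a, t₁)` of `t₀`, `t₁ = (t₀ + T)/2 < T`, inside `(0, T)` and the window
  set t₁ : ℝ := (t₀ + T) / 2 with ht₁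
  have ht₀t₁ : t₀ < t₁ := by rw [ht₁]; linarith
  have ht₁T : t₁ < T := by rw [ht₁]; linarith
  have hnhds : Ioo a t₁ ∈ 𝓝 t₀ := Ioo_mem_nhds ht₀.1 ht₀t₁
  have hcont : ContinuousOn (uncurry u) (Ico 0 T ×ˢ (univ : Set (EuclideanSpace ℝ (Fin 3)))) :=
    hsol.smooth_velocity.continuousOn
  -- the dominating constant
  set B : ℝ := (C / Real.sqrt (T - t₁)) ^ 2 with hB
  have hbound : ∀ t ∈ Ioo a t₁, ∀ x, ‖u t x‖ ^ 2 ≤ B := by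
    intro t ht x
    have htw : t ∈ Ioo (T - δ) T := ⟨by linarith [ht.1], ht.2.trans ht₁T⟩
    have hpos : 0 < Real.sqrt (T - t) := Real.sqrt_pos.2 (sub_pos.2 htw.2)
    have h1 : ‖u t x‖ ≤ C / Real.sqrt (T - t) := by
      rw [le_div_iff₀ hpos, mul_comm]; exact hrate t htw x
    have hC0 : 0 ≤ C := le_trans (mul_nonneg (Real.sqrt_nonneg _) (norm_nonneg _)) (hrate t htw x)
    have h2 : C / Real.sqrt (T - t) ≤ C / Real.sqrt (T - t₁) := by
      refine div_le_div_of_nonneg_left hC0 (Real.sqrt_pos.2 (sub_pos.2 ht₁T)) ?_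
      exact Real.sqrt_le_sqrt (by linarith [ht.2])
    rw [hB]
    exact pow_le_pow_left₀ (norm_nonneg _) (h1.trans h2) 2
  refine continuousAt_of_dominated (bound := fun _ => B) ?_ ?_ ?_ ?_
  · -- measurability of the slices
    filter_upwards [hnhds] with t ht
    have htI : t ∈ Ico 0 T := ⟨by linarith [ht.1], ht.2.trans ht₁T⟩
    exact ((hsol.contDiff_velocity htI).continuous.norm.pow 2).aestronglyMeasurable
  · -- domination
    filter_upwards [hnhds] with t ht
    refine Eventually.of_forall fun x => ?_
    rw [Real.norm_eq_abs, abs_of_nonneg (by positivity)]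
    exact hbound t ht x
  · exact integrableOn_const (measure_ball_lt_top).ne
  · -- continuity of `t ↦ ‖u t x‖²` at `t₀`
    refine Eventually.of_forall fun x => ?_
    have h1 : ContinuousAt (uncurry u) (t₀, x) :=
      hcont.continuousAt (prod_mem_nhds (Ico_mem_nhds ht₀0 ht₀T) univ_mem)
    have h2 : ContinuousAt (fun t : ℝ => (t, x)) t₀ := by fun_prop
    exact ((ContinuousAt.comp_of_eq h1 h2 rfl).norm.pow 2)

/-! ### The Morrey bound of a Type I solution -/

/-- **The Morrey-type Type I condition from the `L^∞` Type I rate** (Barker–Prange 2020,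
(e.typeI), with a solution-dependent constant; Seregin–Šverák 2009, Lemma 3.5 read at every
centre): for `ν > 0`, `T > 0`, a classical solution `(u, p)` on `ℝ³ × [0, T)`, Leray–Hopf on
`[0, T)`, with `IsTypeIBlowup u T`, there are `r₀ > 0`, `M₀` and `T₁ < T` such that
`∫_{B(x₁, ρ)} |u(t, x)|² dx ≤ M₀ ρ` for all `T₁ < t < T`, all `x₁ ∈ ℝ³` and all `0 < ρ ≤ r₀`.
Proof: rate window `(T − δ, T)` (`exists_typeI_rate_window`); fixed scale `R = √(νδ)/2`
(`β = R²/ν = δ/4`); for `t ∈ (T − δ/2, T)` and `ρ ≤ r₀ = R/16` set `r = 2ρ/R ≤ 1/8` and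
`T' = min T (t + βr²/2)`, so that `T' − βr² < t < T'`; the zoom about `(T', x₁)`
(`zoom_unitCyl_data`) satisfies the hypotheses of the symmetry-free Lemma 3.5
(`scaledEnergy_vertex_le_of_typeI`) with data bounded independently of `(T', x₁)`, whence
`A(0, r; w) ≤ Λ < ∞` uniformly; `ae_ball_bound_of_energyA_le` gives the bound for a.e. time in
`(T' − βr², T')` and `continuousOn_setIntegral_ball_norm_sq` (with the tree's
`forall_le_of_ae_le_of_continuousOn`) at the time `t` itself.
[cite: BarkerPrange2020, (e.typeI); SereginSverak2009, Lemma 3.5] -/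
theorem morrey_of_typeI {ν T : ℝ} (hν : 0 < ν) (hT : 0 < T)
    {u : ℝ → EuclideanSpace ℝ (Fin 3) → EuclideanSpace ℝ (Fin 3)} {p : ℝ → EuclideanSpace ℝ (Fin 3) → ℝ}
    (hsol : IsClassicalNSSolutionOn (Ico 0 T) ν 0 u p) (hLH : IsLerayHopfOn T ν 0 (u 0) u)
    (hI : IsTypeIBlowup u T) :
    ∃ r₀ M₀ T₁ : ℝ, 0 < r₀ ∧ T₁ < T ∧
      ∀ t ∈ Ioo T₁ T, ∀ (x₁ : EuclideanSpace ℝ (Fin 3)) (ρ : ℝ), 0 < ρ → ρ ≤ r₀ →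
        ∫ x in ball x₁ ρ, ‖u t x‖ ^ 2 ≤ M₀ * ρ := by
  -- the rate window and the fixed scale
  obtain ⟨C, δ, hC0, hδ, hδT, hrate⟩ := exists_typeI_rate_window hT hI
  set R : ℝ := Real.sqrt (ν * δ) / 2 with hR
  have hRpos : 0 < R := by positivity
  set α : ℝ := R / ν with hα
  set β : ℝ := R ^ 2 / ν with hβdef
  have hαpos : 0 < α := by positivity
  have hβpos : 0 < β := by positivity
  have hβδ : 4 * β = δ := by
    rw [hβdef, hR, div_pow, Real.sq_sqrt (by positivity)]
    field_simp
    ring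
  have hRδ : 4 * (R ^ 2 / ν) ≤ δ := hβδ.le
  -- the affine constants of Lemma 3.5 for the Type I constant `K = αC/√β`
  set K : ℝ := α / Real.sqrt β * C with hK
  obtain ⟨a, d, h35⟩ := scaledEnergy_vertex_le_of_typeI K
  -- the centre-independent data bound and `Λ`
  set UA : ℝ≥0∞ := (ENNReal.ofReal (3 / 4))⁻¹ * (‖α‖ₑ ^ 2 * (ENNReal.ofReal (R ^ 3)⁻¹ *
    ENNReal.ofReal (2 * VectorCalculus.kineticEnergy (u 0)))) with hUA
  set UE : ℝ≥0∞ := (ENNReal.ofReal (3 / 4))⁻¹ * (ENNReal.ofReal ((α * R) ^ 2) *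
    ENNReal.ofReal (β * R ^ 3)⁻¹ *
      ∫⁻ z in Ioo 0 T ×ˢ (univ : Set (EuclideanSpace ℝ (Fin 3))),
        ENNReal.ofReal (frobeniusNormSq (fderiv ℝ (u z.1) z.2))) with hUE
  set UD : ℝ≥0∞ := ‖(α ^ 2 : ℝ)‖ₑ ^ (3 / 2 : ℝ) * ENNReal.ofReal (β * R ^ 3)⁻¹ *
      ∫⁻ z in Ioo 0 T ×ˢ (univ : Set (EuclideanSpace ℝ (Fin 3))),
        ‖p z.1 z.2 - (p z.1 0 - normalisedPressure (u z.1) 0)‖ₑ ^ (3 / 2 : ℝ) with hUD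
  have h34 : (ENNReal.ofReal (3 / 4 : ℝ))⁻¹ ≠ ⊤ := ENNReal.inv_ne_top.2 (by simp)
  have hUAtop : UA ≠ ⊤ :=
    ENNReal.mul_ne_top h34 (ENNReal.mul_ne_top (ENNReal.pow_ne_top enorm_ne_top)
      (ENNReal.mul_ne_top ENNReal.ofReal_ne_top ENNReal.ofReal_ne_top))
  have hUEtop : UE ≠ ⊤ :=
    ENNReal.mul_ne_top h34 (ENNReal.mul_ne_top (ENNReal.mul_ne_top ENNReal.ofReal_ne_top
      ENNReal.ofReal_ne_top) (SereginSverak2002.lintegral_slab_frobeniusNormSq_fderiv_lt_top' hsol hLH).ne)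
  have hUDtop : UD ≠ ⊤ :=
    ENNReal.mul_ne_top (ENNReal.mul_ne_top (ENNReal.rpow_ne_top_of_nonneg (by norm_num) enorm_ne_top)
      ENNReal.ofReal_ne_top) (SereginSverak2002.lintegral_slab_gauged_pressure_lt_top hν hT hsol hLH).ne
  set Λ : ℝ≥0∞ := a * (UA + UE + UD) + d with hΛ
  have hΛtop : Λ ≠ ⊤ :=
    ENNReal.add_ne_top.2 ⟨ENNReal.mul_ne_top ENNReal.coe_ne_top
      (ENNReal.add_ne_top.2 ⟨ENNReal.add_ne_top.2 ⟨hUAtop, hUEtop⟩, hUDtop⟩), ENNReal.coe_ne_top⟩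
  -- the physical constant
  set M₀ : ℝ := (ENNReal.ofReal (R ^ 3) * ((‖α‖ₑ ^ 2)⁻¹ * (ENNReal.ofReal (2 / R) * Λ))).toReal with hM₀
  refine ⟨R / 16, M₀, T - δ / 2, by positivity, by linarith, ?_⟩
  intro t ht x₁ ρ hρ hρR
  -- the rescaled radius `r = 2ρ/R ≤ 1/8` and the top time `T'`
  set r : ℝ := 2 * ρ / R with hr
  have hr0 : 0 < r := by positivity
  have hr8 : r ≤ 1 / 8 := by rw [hr, div_le_iff₀ hRpos]; linarith
  have hrI : r ∈ Ioo (0 : ℝ) (1 / 4) := ⟨hr0, by linarith⟩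
  have hρr : ρ ≤ R * r := by rw [hr]; field_simp; linarith
  set T' : ℝ := min T (t + β * r ^ 2 / 2) with hT'
  have hβr : 0 < β * r ^ 2 := by positivity
  have hT'T : T' ≤ T := min_le_left _ _
  have htT' : t < T' := lt_min ht.2 (by linarith)
  have hT't : T' - β * r ^ 2 < t := by
    have : T' ≤ t + β * r ^ 2 / 2 := min_le_right _ _
    linarith
  have hT'1 : T - δ / 2 < T' := lt_of_lt_of_le (by linarith [ht.1]) htT'.le
  -- the zoom about `(T', x₁)` and Lemma 3.5
  obtain ⟨hsuit, hL3, hGv, htypeI, hA, hE, hD⟩ :=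
    zoom_unitCyl_data hν hT hsol hLH hδT hrate hRpos hRδ hT'1 hT'T x₁
  have h35' := h35 _ _ _ hsuit hL3 hGv htypeI r hrI
  have hAΛ : energyA 0 r (α • stPull β R T' x₁ u) ≤ Λ := by
    refine le_trans (le_self_add.trans (le_self_add.trans le_self_add)) (h35'.trans ?_)
    rw [hΛ]
    gcongr a * ?_ + d
    exact add_le_add (add_le_add hA hE) hD
  -- a.e. in time on `(T' − βr², T')`, then at `t` by continuity
  have hae := ae_ball_bound_of_energyA_le hRpos hαpos hβpos x₁ hr0 hAΛ hρr
  have hr1 : r ^ 2 ≤ 1 := by nlinarith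
  have hβr1 : β * r ^ 2 ≤ β := by nlinarith
  have hlow : T - δ ≤ T' - β * r ^ 2 := by linarith
  have hlow0 : 0 ≤ T' - β * r ^ 2 := by linarith
  have hbound_top : ENNReal.ofReal (R ^ 3) * ((‖α‖ₑ ^ 2)⁻¹ * (ENNReal.ofReal r * Λ)) ≠ ⊤ := by
    refine ENNReal.mul_ne_top ENNReal.ofReal_ne_top (ENNReal.mul_ne_top ?_
      (ENNReal.mul_ne_top ENNReal.ofReal_ne_top hΛtop))
    exact ENNReal.inv_ne_top.2 (pow_ne_zero _ (by simp [hαpos.ne']))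
  have hEq : ENNReal.ofReal (R ^ 3) * ((‖α‖ₑ ^ 2)⁻¹ * (ENNReal.ofReal r * Λ)) =
      (ENNReal.ofReal (R ^ 3) * ((‖α‖ₑ ^ 2)⁻¹ * (ENNReal.ofReal (2 / R) * Λ))) * ENNReal.ofReal ρ := by
    rw [hr, show 2 * ρ / R = 2 / R * ρ by ring, ENNReal.ofReal_mul (by positivity)]
    ring
  have hae' : ∀ᵐ τ ∂(volume.restrict (Ioo (T' - β * r ^ 2) T')),
      ∫ x in ball x₁ ρ, ‖u τ x‖ ^ 2 ≤ M₀ * ρ := by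
    filter_upwards [hae, ae_restrict_mem measurableSet_Ioo] with τ hτ hτI
    have hτT : τ ∈ Icc 0 T := ⟨by linarith [hτI.1], hτI.2.le.trans hT'T⟩
    have hint : IntegrableOn (fun x => ‖u τ x‖ ^ 2) (ball x₁ ρ) :=
      ((hLH.memLp τ hτT).integrable_norm_pow two_ne_zero).integrableOn
    have e : ∫⁻ x in ball x₁ ρ, ‖u τ x‖ₑ ^ 2 = ENNReal.ofReal (∫ x in ball x₁ ρ, ‖u τ x‖ ^ 2) := by
      rw [ofReal_integral_eq_lintegral_ofReal hint (Eventually.of_forall fun x => by positivity)]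
      refine lintegral_congr fun x => ?_
      rw [← ofReal_norm, ENNReal.ofReal_pow (norm_nonneg _)]
    rw [e] at hτ
    have h1 := (ENNReal.ofReal_le_iff_le_toReal hbound_top).1 hτ
    refine h1.trans (le_of_eq ?_)
    -- `(R³ α⁻² r Λ).toReal = M₀ ρ` since `r = (2/R) ρ`
    rw [hEq, ENNReal.toReal_mul, ENNReal.toReal_ofReal hρ.le, hM₀]
  have hcont := continuousOn_setIntegral_ball_norm_sq hsol hδT hrate x₁ ρ
    (a := T' - β * r ^ 2) (b := T') hlow hT'T
  exact forall_le_of_ae_le_of_continuousOn isOpen_Ioo hcont continuousOn_const hae' t ⟨hT't, htT'⟩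

/-! ### The crux from the non-existence of local Type I singular points -/

/-- **`NoTypeIBlowup` (item stmt-NavierStokesRegularity-1217) from `¬ LocalTypeISingularityExists`
ALONE.** If no suitable weak solution of the unforced unit-viscosity Navier–Stokes system has a
Type I singular point in the sense of Albritton–Barker 2019, Thm. 1.1 (backward singular point
with `𝐈 = sup_{Q'} (A + C + D + E) < ∞`; the registered OPEN statement `LocalTypeISingularityExists`
of `LocalTypeI.lean` — false under the Liouville conjecture (L)), then no classical Leray–Hopf
solution from a rapidly decaying datum blows up at the Type I rate. Proof: `morrey_of_typeI`
supplies the Morrey bound, `isBackwardBoundedAt_of_morrey_of_not_localTypeISingularityExists`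
(the zoom is locally Type I) bounds `u` on a backward cylinder at every `(T, x₀)`, and
Lemarié-Rieusset 2016, Thm. 15.1 (C) (`hasSmoothExtensionPast_of_forall_exists_parabolicCylinder`)
continues `u` past `T`. CONDITIONAL on `hno`; it does not close the item.
[cite: AlbrittonBarker2019, Thm. 1.1; LemarieRieusset2016, Thm 15.1 (C)] -/
theorem noTypeIBlowup_of_not_localTypeISingularityExists (hno : ¬ LocalTypeISingularityExists) :
    Summit.NavierStokesRegularity.NavierStokesRegularity.Theses.TypeICertificateLadder.NoTypeIBlowup := by
  unfold Summit.NavierStokesRegularity.NavierStokesRegularity.Theses.TypeICertificateLadder.NoTypeIBlowup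
  intro ν T hν hT u p hsol hLH hdec hI
  obtain ⟨r₀, M₀, T₁, hr₀, hT₁, hMor⟩ := morrey_of_typeI hν hT hsol hLH hI
  refine hasSmoothExtensionPast_of_forall_exists_parabolicCylinder hν hT hsol hLH hdec fun x₀ => ?_
  obtain ⟨r, hr, K, hK⟩ :=
    isBackwardBoundedAt_of_morrey_of_not_localTypeISingularityExists hno hν hT hsol hLH hr₀ hT₁ hMor x₀
  refine ⟨r, hr, ?_⟩
  rw [eLpNorm_exponent_top]
  refine eLpNormEssSup_lt_top_of_ae_bound (C := K) ?_
  refine (ae_restrict_mem (measurableSet_Ioo.prod measurableSet_ball)).mono ?_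
  rintro ⟨t, x⟩ hz
  exact hK t hz.1 x hz.2

/-- **`NoTypeIBlowup` from Albritton–Barker's forward theorem and the non-existence of Type I
blow-up profiles**: `AlbrittonBarkerForward` (A–B 2019, Thm. 1.1, forward direction, named fact:
a local Type I singular point yields a non-trivial mild bounded ancient solution with `𝐈 < ∞`) and
`¬ NontrivialMildAncientTypeIExists` (the second bullet of A–B Thm. 1.1, a registered OPEN
statement, negated) give `¬ LocalTypeISingularityExists`, hence the crux by
`noTypeIBlowup_of_not_localTypeISingularityExists`. CONDITIONAL. [cite: AlbrittonBarker2019, Thm. 1.1] -/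
theorem noTypeIBlowup_of_albrittonBarkerForward_of_not_nontrivialMildAncientTypeIExists
    (hAB : AlbrittonBarkerForward) (hnon : ¬ NontrivialMildAncientTypeIExists) :
    Summit.NavierStokesRegularity.NavierStokesRegularity.Theses.TypeICertificateLadder.NoTypeIBlowup :=
  noTypeIBlowup_of_not_localTypeISingularityExists fun h => hnon (hAB h)

/-- **`NoTypeIBlowup` under the Liouville conjecture (L)** (the KNSS 2009 / Seregin–Šverák 2009
programme "(L) rules out Type I blow-up", for Clay data). Hypotheses: (i) the forward direction of
Albritton–Barker 2019, Thm. 1.1, in measurable-slice form — a local Type I singular point yields a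
non-trivial mild bounded ancient solution `(u, p, G)` with `𝐈 < ∞` whose slices `u t`, `t < 0`,
are a.e.-strongly measurable (true for the printed construction, whose limit is smooth —
Seregin–Šverák 2009 Thm. 2.8, KNSS 2009 §4 — but stronger than the vendored
`AlbrittonBarkerForward`; carried as an explicit hypothesis, cf. `LocalTypeILiouville.lean`);
(ii) (L) = `LiouvilleConjectureNS` (bounded ancient mild solutions have spatially constant slices;
items stmt-NavierStokesRegularity-0057 and stmt-NavierStokesRegularity-10661). Then (L) refutes the profile
(`LiouvilleConjectureNS.not_nontrivialMildAncientTypeIExists_measurable`: constants are excluded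
by `𝐈 < ∞`), so no local Type I singular point exists, and
`noTypeIBlowup_of_not_localTypeISingularityExists` applies. CONDITIONAL; it does not close item 1217.
[cite: KochNadirashviliSereginSverak2009, §1 and §6; AlbrittonBarker2019, Thm. 1.1 and §1] -/
theorem noTypeIBlowup_of_liouvilleConjectureNS
    (hABm : LocalTypeISingularityExists →
      ∃ (u : ℝ → EuclideanSpace ℝ (Fin 3) → EuclideanSpace ℝ (Fin 3))
        (p : ℝ → EuclideanSpace ℝ (Fin 3) → ℝ)
        (G : ℝ → EuclideanSpace ℝ (Fin 3) → EuclideanSpace ℝ (Fin 3) →L[ℝ] EuclideanSpace ℝ (Fin 3)),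
      (∀ t < 0, AEStronglyMeasurable (u t) volume) ∧
      IsBoundedAncientMildSolution 1 u ∧
      IsSuitableWeakSolutionOn
        (slab (EuclideanSpace ℝ (Fin 3)) (Iio 0) isOpen_Iio) 1 0 u p ∧
      HasWeakSpatialGradientOn
        (slab (EuclideanSpace ℝ (Fin 3)) (Iio 0) isOpen_Iio) u G ∧
      ¬ (uncurry u =ᵐ[volume.restrict
        (Iio (0 : ℝ) ×ˢ (univ : Set (EuclideanSpace ℝ (Fin 3))))] 0) ∧
      typeIBound (Iio (0 : ℝ) ×ˢ (univ : Set (EuclideanSpace ℝ (Fin 3)))) u p G < ∞)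
    (hL : LiouvilleConjectureNS) :
    Summit.NavierStokesRegularity.NavierStokesRegularity.Theses.TypeICertificateLadder.NoTypeIBlowup :=
  noTypeIBlowup_of_not_localTypeISingularityExists fun h =>
    hL.not_nontrivialMildAncientTypeIExists_measurable (hABm h)

end Summit.NavierStokesRegularity.NavierStokesRegularity.Theorems

end
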